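import Summits.ABC.IUTFork.LDHSplitLocusDisplay
import Summits.ABC.ABC.Theorems.IUTThetaPilotThetaPartIIStubThetaData
import Literature.IUT.LogVolume.WeightDescent
import Literature.IUT.LogVolume.GenuineSupportPrimesBound
import HarnessLib

/-!
# The fork at [IUTchIII] Corollary 3.12, L-DH level: the split-bad locus READ ON THE POINT — v4's CONE binder `hreg`
# ALONE gives [IUTchIV] Thm. 1.10 (`Cor22.Thm110Legendre`) at every admissible `λ` whose bad places split enough

Proof-only sequel (D-0012; 0 definitions, no `Prop` fact) of `LDHSplitLocusDisplay.lean` (abc-iut-s2-p4, p434756; R2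
S-CHAIN TEAM TARGET #1 «hvol/hreg residue»). TAKES NO SIDE on [IUTchIII] Cor. 3.12 or on [IUTchIV] Thm. 1.10.
S. Mochizuki, *IUT IV* [Mochizuki2012], Thm. 1.10 (pp. 22–31; Step (v) pp. 27–28), Cor. 2.2 (ii) proof (P5)/(P7)
p. 46; Dupuy–Hilado [DupuyHilado2025] §3.6 (weights `Pr(v) = n_v/[F:ℚ]`), §4.7, §4.12; Neukirch, *Algebraic Number
Theory*, Ch. I (8.2) (fundamental identity).

`LDHSplitLocusDisplay` states the split-bad locus DATUM BY DATUM: «the `𝕍^bad_mod` of the datum's initial Θ-data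
carries bad mass `≤ 1/2` over every support prime». THIS FILE reads the locus ON THE POINT `P = (F_tpd, λ)`, in the
`λ`-line vocabulary of abc-iut-S-d2 (`Cor22.badPlacesAvoid P {2,l}` = the poles of `j(λ)` in `F_tpd = ℚ(λ)` not
dividing `2l`, `weight F_tpd V = n_V/[F_tpd:ℚ]`):

* `sum_ite_finBelow_weight_eq` — weight descent with a condition read below: for number fields `K ⊇ F₀`, a prime `p`
  and any finite set `B` of places of `F₀`, `Σ_{x ∈ V(K)_p, x|B} Pr_K(x) = Σ_{v ∈ V(F₀)_p ∩ B} Pr_{F₀}(v)`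
  (abc-iut-L5/S-lane `WeightDescent.sum_filter_finBelow_weight`, fibrewise);
* `PointDict.finBelow_mem_badPlacesAvoid_of_mem_VFbad` — a place of the datum's field `F` in `𝕍(F)^bad` (the (P5)
  choice: `∤ 2l`, multiplicative reduction) lies over a pole of `j(λ)` in `F_tpd` not dividing `2l` (abc-iut-S3's
  argument in `GenuineSupportPrimesBound`, isolated);
* **`PointDict.badMass_le_badMassPoint`** — for every genuine Θ-volume datum `T` at `(P, l)` and every prime `p`:
  `Σ_{v | p, v ∈ 𝕍^bad_mod(T.D)} Pr_{F_mod}(v) ≤ Σ_{V | p, V ∈ badPlacesAvoid P {2,l}} Pr_{F_tpd}(V)` (both read in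
  `V(F)_p` by weight descent along `F/F_mod` and `F/F_tpd`, then compared place by place) — so the POINT condition
  «every prime carries `j(λ)`-pole mass `≤ 1/2` in `ℚ(λ)` away from `2l`» puts EVERY datum at `(P,l)` on the locus;
* **`thm110Display_of_hreg_of_splitBadPoint`** — from a hypothesis with the EXACT type of v4's `hreg`
  (`Conditional.abc_of_S_v4`, p431657): for every `IsEtaPrm η`, every `P ∈ U_P`, prime `l ≥ 5` with
  `AdmitsCore/CondP2/CondP5/CondP6`, IF `Σ_{V | p, V ∈ badPlacesAvoid P {2,l}} Pr_{F_tpd}(V) ≤ 1/2` for every prime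
  `p`, THEN `Cor22.Display P l η` — i.e. `hreg` ALONE proves `Cor22.Thm110Legendre` RESTRICTED TO THE SPLIT-BAD LOCUS
  (a datum exists by abc-iut-L5-t7's `ThetaPartII.stub_thetaData`; the Corollary stub is a theorem there and the
  regime antecedent fires, p434756). `thm110Display_of_hvol_of_splitBadPoint` — the same from v3's `hvol`;
  `cor312AtDatum_of_splitBadPoint` — on the point locus `Cor22.Cor312AtDatum P l` (the (U)-line's disputed stub) HOLDS.

READING (for the C lead / §H / s2 SCOREBOARD §4; nothing asserted about print). With every object Θ-free: the branch-C
certificate's remaining CONE binder `hreg` implies, with NO input from [IUTchIII] Cor. 3.12, [IUTchIV] Thm. 1.10's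
inequality `(1/6)·log(q^{∤{2,l}}(λ)) ≤ (1 + 20·d_mod/l)·(log-diff + log-cond) + 20·(d*_mod·l + η)` at EVERY admissible
`(λ, l)` with `[ℚ(j(λ)):ℚ] ≥ 2` all of whose `j(λ)`-poles `∤ 2l` sit over rational primes carrying pole mass `≤ 1/2` —
an effective Szpiro/Vojta-type statement about every admissible `λ` on that locus (for `F_tpd = ℚ(i)`: `λ = a/c` from
a coprime Gaussian triple `a + b = c` whose product `abc` has no odd rational prime divisor other than `l`; the locus is
EXPECTED — density heuristics — but NOT proved here to contain points of unbounded height; no infinite family is exhibited,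
and «`j(λ)` integral away from one fixed prime» would be a FINITE set by the `S`-unit theorem — erratum to the first
accepted revision's parenthetical, abc-iut-s2-p4 STATUS 10:0xZ). Closing `hreg` proves it; refuting `hreg` exhibits an
admissible split-bad `λ` violating it. This is the datum-free form of «(ii′-U) at `d_mod > 1` is Szpiro-type»
(C-cert-2 «ABC_OF_S HYPS (7)» row (5)). `logQAvoid_le_of_hreg_of_splitBadPoint` records the resulting explicit upper
threshold `log(q^{∤{2,l}}(λ)) ≤ (B_III(P,l) + ((l+5)/4)·log π)/((l+1)/24 − 1/(2l))` next to abc-iut-c312-d1's lower one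
(`hullVolumeAtDatum_BIII_of_logQAvoid_le`: `log q ≤ 40·log(d*l)·(π(d*l) − …)` ⟹ the hull estimate), both with leading term
`≈ 40·log(d*_mod·l)·π(d*_mod·l)`. HONEST SCOPE: consequences of the typed (U)-objects ((Ind1) = all capsule-index
permutations, R2); no side taken on Cor. 3.12 / Thm. 1.10 or on any author; typed ≠ proved. PROOF-ONLY file.
[cite: Mochizuki2012, IUTchIV Thm. 1.10 Step (v) p. 27–28] [cite: Mochizuki2012, IUTchIV Cor. 2.2 (ii) proof p. 46]
[cite: DupuyHilado2025, §3.6, §4.7, §4.12] [cite: NeukirchANT1999, Ch. I §8 Prop. (8.2)]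
[claim: Mochizuki2012, status: disputed] for every IUT quotation.
-/

noncomputable section

namespace Summit.ABC.IUTFork

open Literature.IUT.HodgeTheaters Literature.IUT.LogVolume NumberField IsDedekindDomain
open Literature.NumberTheory.DiophantineGeometry.GenEll
open Summit.ABC.ABC.Theorems

/-! ## Weight descent with a condition read on the place below -/

open scoped Classical in
/-- **Weight descent, condition read below**: for number fields `K ⊇ F₀`, a rational prime `p` and a finite set `B` of
finite places of `F₀`, `Σ_{x ∈ V(K)_p : x ∩ 𝓞_{F₀} ∈ B} Pr_K(x) = Σ_{v ∈ V(F₀)_p ∩ B} Pr_{F₀}(v)` — sum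
`WeightDescent.sum_filter_finBelow_weight` (`Σ_{x | v} Pr_K(x) = Pr_{F₀}(v)`, the fundamental identity divided by the
tower law) over the fibres of `V(K)_p → V(F₀)_p`. [cite: NeukirchANT1999, Ch. I §8 Prop. (8.2)] [cite: DupuyHilado2025, §3.6] -/
theorem sum_ite_finBelow_weight_eq (F₀ K : Type) [Field F₀] [NumberField F₀] [Field K] [NumberField K] [Algebra F₀ K]
    {p : ℕ} [Fact p.Prime] (B : Finset (HeightOneSpectrum (𝓞 F₀))) :
    ∑ x ∈ placesOver K p, (if finBelow F₀ K x ∈ B then weight K x else 0) =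
      ∑ v ∈ placesOver F₀ p, (if v ∈ B then weight F₀ v else 0) := by
  classical
  rw [← Finset.sum_fiberwise_of_maps_to (s := placesOver K p) (t := placesOver F₀ p) (g := finBelow F₀ K)
    (fun x hx => finBelow_mem_placesOver F₀ K hx)]
  refine Finset.sum_congr rfl fun v hv => ?_
  by_cases hvB : v ∈ B
  · rw [if_pos hvB, ← sum_filter_finBelow_weight F₀ K v hv]
    refine Finset.sum_congr rfl fun x hx => ?_
    rw [(Finset.mem_filter.mp hx).2, if_pos hvB]
  · rw [if_neg hvB]
    refine Finset.sum_eq_zero fun x hx => ?_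
    rw [(Finset.mem_filter.mp hx).2, if_neg hvB]

open scoped Classical in
/-- Indicator sums over the subtype `V(F)_p` are the `if`-sums over the finite set. [cite: DupuyHilado2025, §3.6] -/
private theorem sum_indicator_eq_sum_ite {F : Type} [Field F] [NumberField F] {p : ℕ}
    (B : Finset (HeightOneSpectrum (𝓞 F))) :
    ∑ v : placesOver F p, ((B : Finset _) : Set (HeightOneSpectrum (𝓞 F))).indicator (weight F) v.1 =
      ∑ v ∈ placesOver F p, (if v ∈ B then weight F v else 0) := by
  classical
  rw [← Finset.sum_coe_sort (placesOver F p)]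
  refine Finset.sum_congr rfl fun v _ => ?_
  rw [Set.indicator_apply]
  simp only [Finset.mem_coe]

namespace PointDict

variable {P : NFPoint} {l : ℕ}

/-! ## A bad place of the datum's field lies over a pole of `j(λ)` away from `2l` -/

/-- **A place of `F` in `𝕍(F)^bad` lies over a bad-away-from-`{2,l}` place of `F_tpd`.** For a genuine Θ-volume
datum `T` at `(P, l)` and a finite place `x` of its field `F`: if `x ∈ 𝕍(F)^bad` (by the (P5) choice `T.isP5Choice`:
`x ∤ 2`, `x ∤ l`, `E_F` multiplicative at `x`), then the place `x ∩ 𝓞_{F_tpd}` of `F_tpd` is a pole of `j(λ)` not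
dividing `2l` (`j(E_F) = j(λ)` by `T.j_eq`; multiplicative ⟹ `ord_x j(E_F) < 0`, abc-iut-S2; the sign of `ord` and the
residue characteristic descend, abc-iut-S3). [cite: Mochizuki2012, IUTchIV Cor. 2.2 (ii) proof (P5) p. 46] -/
theorem finBelow_mem_badPlacesAvoid_of_mem_VFbad (T : Cor22.ThetaVolumeDatumAt P l) :
    letI := T.instFieldF; letI := T.instNumberFieldF; letI := T.instAlgebraF; letI := T.instFieldK
    letI := T.instNumberFieldK; letI := T.instAlgebraK; letI := T.instFieldFbar; letI := T.instAlgebraFbar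
    letI := T.instAlgebraKFbar; letI := T.instIsElliptic
    ∀ x : HeightOneSpectrum (𝓞 T.F), FinitePlace.mk x ∈ T.D.VFbad →
      finBelow P.F T.F x ∈ Cor22.badPlacesAvoid P {2, l} := by
  classical
  letI := T.instFieldF; letI := T.instNumberFieldF; letI := T.instAlgebraF; letI := T.instFieldK
  letI := T.instNumberFieldK; letI := T.instAlgebraK; letI := T.instFieldFbar; letI := T.instAlgebraFbar
  letI := T.instAlgebraKFbar; letI := T.instIsElliptic
  intro x hx
  have hP5 := (T.isP5Choice (FinitePlace.mk x)).mp hx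
  rw [FinitePlace.maximalIdeal_mk] at hP5
  have hordx : ord T.F x T.E.j < 0 := ThetaData.ord_j_neg_of_hasMultiplicativeReductionAt hP5.2
  rw [T.j_eq] at hordx
  unfold Cor22.badPlacesAvoid
  rw [Finset.mem_filter, Cor22.mem_badPlaces_iff_ord_neg]
  refine ⟨(Cor22.ord_algebraMap_neg_iff x (Cor22.jInv P.x)).mp hordx, fun q hq hmem => ?_⟩
  exact hP5.1 q hq ((Cor22.natCast_mem_asIdeal_finBelow_iff (F := P.F) x q).mp hmem)

/-! ## The datum's bad mass is at most the point's `j(λ)`-pole mass -/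

/-- **The bad mass of the datum is dominated by the pole mass of the point**: for a genuine Θ-volume datum `T` at
`(P, l)` and a rational prime `p`,
`Σ_{v ∈ V(F_mod)_p, v ∈ 𝕍^bad_mod} Pr_{F_mod}(v) ≤ Σ_{V ∈ V(F_tpd)_p, V ∈ badPlacesAvoid P {2,l}} Pr_{F_tpd}(V)`.
Both sides are read in `V(F)_p` by weight descent along `F ⊇ F_mod` and `F ⊇ F_tpd` (`sum_ite_finBelow_weight_eq`);
there `x ∩ 𝓞_{F_mod} ∈ 𝕍^bad_mod ⟺ x ∈ 𝕍(F)^bad` (abc-iut-S2 `ThetaData.mk_mem_VFbad_iff`) `⟹ x ∩ 𝓞_{F_tpd}` is a pole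
of `j(λ)` away from `2l` (`finBelow_mem_badPlacesAvoid_of_mem_VFbad`). (Equality holds — semistability of `E_F` — but
only this direction is used.) [cite: Mochizuki2012, IUTchIV Cor. 2.2 (ii) proof (P5) p. 46] [cite: DupuyHilado2025, §3.6] -/
theorem badMass_le_badMassPoint (T : Cor22.ThetaVolumeDatumAt P l) (p : ℕ) [Fact p.Prime] :
    (letI := T.instFieldF; letI := T.instNumberFieldF; letI := T.instAlgebraF; letI := T.instFieldK
     letI := T.instNumberFieldK; letI := T.instAlgebraK; letI := T.instFieldFbar; letI := T.instAlgebraFbar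
     letI := T.instAlgebraKFbar; letI := T.instIsElliptic
     ∑ v : placesOver (fieldOfModuli T.E) p,
        ((ThetaData.badPrimesMod T.D : Finset _) : Set (HeightOneSpectrum (𝓞 (fieldOfModuli T.E)))).indicator
          (weight (fieldOfModuli T.E)) v.1) ≤
      ∑ V : placesOver P.F p,
        ((Cor22.badPlacesAvoid P {2, l} : Finset _) : Set (HeightOneSpectrum (𝓞 P.F))).indicator (weight P.F) V.1 := by
  classical
  letI := T.instFieldF; letI := T.instNumberFieldF; letI := T.instAlgebraF; letI := T.instFieldK
  letI := T.instNumberFieldK; letI := T.instAlgebraK; letI := T.instFieldFbar; letI := T.instAlgebraFbar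
  letI := T.instAlgebraKFbar; letI := T.instIsElliptic
  rw [sum_indicator_eq_sum_ite, sum_indicator_eq_sum_ite,
    ← sum_ite_finBelow_weight_eq (fieldOfModuli T.E) T.F (ThetaData.badPrimesMod T.D),
    ← sum_ite_finBelow_weight_eq P.F T.F (Cor22.badPlacesAvoid P {2, l})]
  refine Finset.sum_le_sum fun x _ => ?_
  by_cases hx : finBelow (fieldOfModuli T.E) T.F x ∈ ThetaData.badPrimesMod T.D
  · -- `x ∩ 𝓞_{F_mod}` bad ⟹ `x ∈ 𝕍(F)^bad` ⟹ `x ∩ 𝓞_{F_tpd}` is a pole of `j(λ)` away from `2l`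
    have hunder : x.under (𝓞 (fieldOfModuli T.E)) ∈ ThetaData.badPrimesMod T.D := by
      have he : finBelow (fieldOfModuli T.E) T.F x = x.under (𝓞 (fieldOfModuli T.E)) :=
        HeightOneSpectrum.ext (by rw [HeightOneSpectrum.under_asIdeal]; rfl)
      rwa [he] at hx
    have hVF : FinitePlace.mk x ∈ T.D.VFbad := (ThetaData.mk_mem_VFbad_iff T.D x).mpr hunder
    have hB := finBelow_mem_badPlacesAvoid_of_mem_VFbad T x hVF
    rw [if_pos hx, if_pos hB]
  · rw [if_neg hx]
    exact ite_nonneg (weight_nonneg T.F x) le_rfl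

/-- **The point condition puts every datum on the split-bad locus**: if every rational prime `p` carries `j(λ)`-pole
mass `≤ 1/2` in `F_tpd` away from `2l` (`Σ_{V | p, V ∈ badPlacesAvoid P {2,l}} Pr_{F_tpd}(V) ≤ 1/2`), then every genuine
Θ-volume datum at `(P, l)` has bad mass `≤ 1/2` over every support prime. [cite: Mochizuki2012, IUTchIV Cor. 2.2 (ii) proof (P5) p. 46] -/
theorem badMass_le_half_of_splitBadPoint (T : Cor22.ThetaVolumeDatumAt P l)
    (hsplit : ∀ (p : ℕ) [Fact p.Prime], ∑ V : placesOver P.F p,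
      ((Cor22.badPlacesAvoid P {2, l} : Finset _) : Set (HeightOneSpectrum (𝓞 P.F))).indicator (weight P.F) V.1 ≤ 1 / 2) :
    letI := T.instFieldF; letI := T.instNumberFieldF; letI := T.instAlgebraF; letI := T.instFieldK
    letI := T.instNumberFieldK; letI := T.instAlgebraK; letI := T.instFieldFbar; letI := T.instAlgebraFbar
    letI := T.instAlgebraKFbar; letI := T.instIsElliptic
    ∀ p ∈ T.I.supportPrimes, ∑ v : placesOver (fieldOfModuli T.E) p,
      ((ThetaData.badPrimesMod T.D : Finset _) : Set (HeightOneSpectrum (𝓞 (fieldOfModuli T.E)))).indicator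
        (weight (fieldOfModuli T.E)) v.1 ≤ 1 / 2 := by
  letI := T.instFieldF; letI := T.instNumberFieldF; letI := T.instAlgebraF; letI := T.instFieldK
  letI := T.instNumberFieldK; letI := T.instAlgebraK; letI := T.instFieldFbar; letI := T.instAlgebraFbar
  letI := T.instAlgebraKFbar; letI := T.instIsElliptic
  intro p hp
  haveI : Fact p.Prime := ⟨T.I.prime_of_mem_supportPrimes hp⟩
  exact (badMass_le_badMassPoint T p).trans (hsplit p)

/-- **On the point locus the (U)-line's disputed stub HOLDS**: if every rational prime carries `j(λ)`-pole mass `≤ 1/2`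
in `F_tpd` away from `2l`, then `Cor22.Cor312NonarchAtDatum P l ∧ Cor22.Cor312AtDatum P l` — the typed Cor. 3.12
(union-hull reading) at EVERY genuine Θ-volume datum of `(P, l)` is a theorem (p434756 `cor312AtDatum_of_badMass_le_half`
on the point locus). A statement about OUR typed objects ((Ind1) = all capsule-index permutations); nothing asserted
about print's Cor. 3.12. [claim: Mochizuki2012, status: disputed] [cite: DupuyHilado2025, §3.6, §4.7, §4.12] -/
theorem cor312AtDatum_of_splitBadPoint
    (hsplit : ∀ (p : ℕ) [Fact p.Prime], ∑ V : placesOver P.F p,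
      ((Cor22.badPlacesAvoid P {2, l} : Finset _) : Set (HeightOneSpectrum (𝓞 P.F))).indicator (weight P.F) V.1 ≤ 1 / 2) :
    Cor22.Cor312NonarchAtDatum P l ∧ Cor22.Cor312AtDatum P l :=
  cor312AtDatum_of_badMass_le_half fun T => badMass_le_half_of_splitBadPoint T hsplit

/-- **On the point locus the (U)-computable half ALONE gives the display**: `λ ∈ U_X`, `l ≥ 5` prime, `l ≠ 5`,
`IsEtaPrm η`, the point condition, a datum `T` with `T.HullEstimateOf (B_III P l)` ⟹ `Cor22.Display P l η`
(Cor.-3.12-free). [claim: Mochizuki2012, status: disputed] [cite: Mochizuki2012, IUTchIV Thm. 1.10 Steps (v), (viii) p. 27–31] -/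
theorem display_of_hullEstimateOf_of_splitBadPoint (T : Cor22.ThetaVolumeDatumAt P l) (hU : P.InU)
    (hl : l.Prime) (h5 : 5 ≤ l) (hne : l ≠ 5) {η : ℝ} (hη : IsEtaPrm η)
    (hsplit : ∀ (p : ℕ) [Fact p.Prime], ∑ V : placesOver P.F p,
      ((Cor22.badPlacesAvoid P {2, l} : Finset _) : Set (HeightOneSpectrum (𝓞 P.F))).indicator (weight P.F) V.1 ≤ 1 / 2)
    (h : T.HullEstimateOf
      (((l : ℝ) + 1) / 4 *
        ((1 + 12 * (Cor22.dmod P : ℝ) / l) * (P.logDiff + Cor22.logCondAvoid P {2, l})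
          + 2 * Real.log l + 52
          + 20 / 3 * Real.log (((2 ^ 12 * 3 ^ 3 * 5 * Cor22.dmod P : ℕ) : ℝ) * (l : ℝ))
            * (Nat.primeCounting (2 ^ 12 * 3 ^ 3 * 5 * Cor22.dmod P * l) : ℝ)))) :
    Cor22.Display P l η :=
  display_of_hullEstimateOf_of_badMass_le_half T hU hl h5 hne hη (badMass_le_half_of_splitBadPoint T hsplit) h

end PointDict

/-! ## From the certificate binders `hreg` (v4) / `hvol` (v3), verbatim, to Thm. 1.10 on the point locus -/

open PointDict

/-- (P6) fails at `l = 5` for a point of `U_X`, so an admissible `l ≥ 5` is `≠ 5` (abc-iut-S-d1).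
[cite: Mochizuki2012, IUTchIV Cor. 2.2 (ii) proof p. 46] -/
private theorem ne_five_of_condP6' {P : NFPoint} (hU : P.InU) {l : ℕ} (h6 : Cor22.CondP6 P l) : l ≠ 5 := by
  rintro rfl
  obtain ⟨F, hNF, hF⟩ := Cor22.exists_isThetaField (P := P) hU
  exact Cor22.not_condP6_five_of_isThetaField hU F hF h6

/-- **[IUTchIV] Thm. 1.10 ON THE SPLIT-BAD LOCUS FROM v4's `hreg` ALONE.** From a hypothesis with the EXACT type of the
CONE binder `hreg` of `Conditional.abc_of_S_v4` (p431657; = the body of the registered stub `stub_hullRegime` of crux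
`ThetaPartII`, stmt-ABC-19678): for every `IsEtaPrm η`, every `P ∈ U_P` (minimally presented `λ ∈ U_X`), every prime
`l ≥ 5` with `AdmitsCore`, `CondP2`, `CondP5`, `CondP6` — the binders of `Cor22.Thm110Legendre` — IF every rational
prime carries `j(λ)`-pole mass `≤ 1/2` in `ℚ(λ)` away from `2l`, THEN `Cor22.Display P l η`: the display of Thm. 1.10 as
consumed by Cor. 2.2, with NO input from [IUTchIII] Cor. 3.12. (A datum exists: abc-iut-L5-t7 `ThetaPartII.stub_thetaData`;
on the locus the typed Corollary holds and the regime antecedent fires: p434756.) READING: `hreg` restricted to the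
split-bad locus is AT LEAST AS STRONG AS Thm. 1.10 there — closing it proves an effective Szpiro/Vojta-type
inequality for every admissible `λ` on the locus (expected, not proved here, to be of unbounded height), refuting it
exhibits an admissible split-bad `λ` violating that inequality; neither is a volume computation. Nothing asserted about any point or about print; no side taken.
[claim: Mochizuki2012, status: disputed] [cite: Mochizuki2012, IUTchIV Thm. 1.10 pp. 22–31]
[cite: Mochizuki2012, IUTchIV Cor. 2.2 (ii) proof p. 46] -/
theorem thm110Display_of_hreg_of_splitBadPoint
    (hreg : ∀ P : NFPoint, P ∈ UP → ∀ l : ℕ, l.Prime → 5 ≤ l →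
      Cor22.AdmitsCore P → Cor22.CondP2 P l → Cor22.CondP5 P l → Cor22.CondP6 P l →
      ∀ T : Cor22.ThetaVolumeDatumAt P l,
        (letI := T.instFieldF; letI := T.instNumberFieldF; letI := T.instAlgebraF; letI := T.instFieldK
         letI := T.instNumberFieldK; letI := T.instAlgebraK; letI := T.instFieldFbar; letI := T.instAlgebraFbar
         letI := T.instAlgebraKFbar; letI := T.instIsElliptic
         ¬ (∀ p ∈ T.I.supportPrimes, ∀ v w : placesOver (fieldOfModuli T.E) p,
            (Summit.ABC.IUTFork.DHData.ofInput T.I).logQloc p v = (Summit.ABC.IUTFork.DHData.ofInput T.I).logQloc p w)) →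
        T.HullEstimateOf
          (((l : ℝ) + 1) / 4 *
            ((1 + 12 * (Cor22.dmod P : ℝ) / l) * (P.logDiff + Cor22.logCondAvoid P {2, l})
              + 2 * Real.log l + 52
              + 20 / 3 * Real.log (((2 ^ 12 * 3 ^ 3 * 5 * Cor22.dmod P : ℕ) : ℝ) * (l : ℝ))
                * (Nat.primeCounting (2 ^ 12 * 3 ^ 3 * 5 * Cor22.dmod P * l) : ℝ))))
    {η : ℝ} (hη : IsEtaPrm η) {P : NFPoint} (hP : P ∈ UP) {l : ℕ} (hl : l.Prime) (h5 : 5 ≤ l)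
    (hc : Cor22.AdmitsCore P) (h2 : Cor22.CondP2 P l) (h5' : Cor22.CondP5 P l) (h6 : Cor22.CondP6 P l)
    (hsplit : ∀ (p : ℕ) [Fact p.Prime], ∑ V : placesOver P.F p,
      ((Cor22.badPlacesAvoid P {2, l} : Finset _) : Set (HeightOneSpectrum (𝓞 P.F))).indicator (weight P.F) V.1 ≤ 1 / 2) :
    Cor22.Display P l η := by
  obtain ⟨T⟩ := ThetaPartII.stub_thetaData P hP l hl h5 hc h2 h5' h6
  exact display_of_hreg_of_badMass_le_half hreg hP hl h5 hc h2 h5' h6 T (badMass_le_half_of_splitBadPoint T hsplit) hη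

/-- **The same from v3's `hvol`** (`Conditional.abc_of_S_v3`, p430884; binder type verbatim): Thm. 1.10's display on the
point locus, Cor.-3.12-free. [claim: Mochizuki2012, status: disputed] [cite: Mochizuki2012, IUTchIV Thm. 1.10 pp. 22–31] -/
theorem thm110Display_of_hvol_of_splitBadPoint
    (hvol : ∀ P₀ : NFPoint, P₀ ∈ UP → ∀ l : ℕ, l.Prime → 5 ≤ l →
      Cor22.AdmitsCore P₀ → Cor22.CondP2 P₀ l → Cor22.CondP5 P₀ l → Cor22.CondP6 P₀ l →
        Cor22.HullVolumeAtDatum P₀ l (((l : ℝ) + 1) / 4 *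
          ((1 + 12 * (Cor22.dmod P₀ : ℝ) / l) * (P₀.logDiff + Cor22.logCondAvoid P₀ {2, l})
            + 2 * Real.log l + 52
            + 20 / 3 * Real.log (((2 ^ 12 * 3 ^ 3 * 5 * Cor22.dmod P₀ : ℕ) : ℝ) * (l : ℝ))
              * (Nat.primeCounting (2 ^ 12 * 3 ^ 3 * 5 * Cor22.dmod P₀ * l) : ℝ))))
    {η : ℝ} (hη : IsEtaPrm η) {P : NFPoint} (hP : P ∈ UP) {l : ℕ} (hl : l.Prime) (h5 : 5 ≤ l)
    (hc : Cor22.AdmitsCore P) (h2 : Cor22.CondP2 P l) (h5' : Cor22.CondP5 P l) (h6 : Cor22.CondP6 P l)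
    (hsplit : ∀ (p : ℕ) [Fact p.Prime], ∑ V : placesOver P.F p,
      ((Cor22.badPlacesAvoid P {2, l} : Finset _) : Set (HeightOneSpectrum (𝓞 P.F))).indicator (weight P.F) V.1 ≤ 1 / 2) :
    Cor22.Display P l η := by
  obtain ⟨T⟩ := ThetaPartII.stub_thetaData P hP l hl h5 hc h2 h5' h6
  exact display_of_hvol_of_badMass_le_half hvol hP hl h5 hc h2 h5' h6 T (badMass_le_half_of_splitBadPoint T hsplit) hη

/-- **The squeeze form from `hreg`, on the point locus** (no `η`): `((l+1)/24 − 1/(2l))·log(q^{∤{2,l}}(λ)) ≤ B_III(P,l) +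
((l+5)/4)·log π` at every admissible `(P, l)` whose `j(λ)`-pole mass is `≤ 1/2` at every prime.
[claim: Mochizuki2012, status: disputed] [cite: Mochizuki2012, IUTchIV Thm. 1.10 Step (viii) p. 30–31] -/
theorem squeeze_of_hreg_of_splitBadPoint
    (hreg : ∀ P : NFPoint, P ∈ UP → ∀ l : ℕ, l.Prime → 5 ≤ l →
      Cor22.AdmitsCore P → Cor22.CondP2 P l → Cor22.CondP5 P l → Cor22.CondP6 P l →
      ∀ T : Cor22.ThetaVolumeDatumAt P l,
        (letI := T.instFieldF; letI := T.instNumberFieldF; letI := T.instAlgebraF; letI := T.instFieldK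
         letI := T.instNumberFieldK; letI := T.instAlgebraK; letI := T.instFieldFbar; letI := T.instAlgebraFbar
         letI := T.instAlgebraKFbar; letI := T.instIsElliptic
         ¬ (∀ p ∈ T.I.supportPrimes, ∀ v w : placesOver (fieldOfModuli T.E) p,
            (Summit.ABC.IUTFork.DHData.ofInput T.I).logQloc p v = (Summit.ABC.IUTFork.DHData.ofInput T.I).logQloc p w)) →
        T.HullEstimateOf
          (((l : ℝ) + 1) / 4 *
            ((1 + 12 * (Cor22.dmod P : ℝ) / l) * (P.logDiff + Cor22.logCondAvoid P {2, l})
              + 2 * Real.log l + 52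
              + 20 / 3 * Real.log (((2 ^ 12 * 3 ^ 3 * 5 * Cor22.dmod P : ℕ) : ℝ) * (l : ℝ))
                * (Nat.primeCounting (2 ^ 12 * 3 ^ 3 * 5 * Cor22.dmod P * l) : ℝ))))
    {P : NFPoint} (hP : P ∈ UP) {l : ℕ} (hl : l.Prime) (h5 : 5 ≤ l)
    (hc : Cor22.AdmitsCore P) (h2 : Cor22.CondP2 P l) (h5' : Cor22.CondP5 P l) (h6 : Cor22.CondP6 P l)
    (hsplit : ∀ (p : ℕ) [Fact p.Prime], ∑ V : placesOver P.F p,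
      ((Cor22.badPlacesAvoid P {2, l} : Finset _) : Set (HeightOneSpectrum (𝓞 P.F))).indicator (weight P.F) V.1 ≤ 1 / 2) :
    (((l : ℝ) + 1) / 24 - 1 / (2 * l)) * Cor22.logQAvoid P {2, l} ≤
      ((l : ℝ) + 1) / 4 *
          ((1 + 12 * (Cor22.dmod P : ℝ) / l) * (P.logDiff + Cor22.logCondAvoid P {2, l})
            + 2 * Real.log l + 52
            + 20 / 3 * Real.log (((2 ^ 12 * 3 ^ 3 * 5 * Cor22.dmod P : ℕ) : ℝ) * (l : ℝ))
              * (Nat.primeCounting (2 ^ 12 * 3 ^ 3 * 5 * Cor22.dmod P * l) : ℝ))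
        + ThetaVolumeInput.archLogTheta l := by
  obtain ⟨T⟩ := ThetaPartII.stub_thetaData P hP l hl h5 hc h2 h5' h6
  exact squeeze_of_hreg_of_badMass_le_half hreg hP hl h5 hc h2 h5' h6 T (badMass_le_half_of_splitBadPoint T hsplit)


/-- **The explicit upper height threshold carried by `hreg` on the point locus.** From v4/v5K's CONE binder `hreg`
verbatim: at every admissible `(P, l)` (`P ∈ U_P`, `l ≥ 5` prime, `AdmitsCore/CondP2/CondP5/CondP6`) all of whose
`j(λ)`-poles `∤ 2l` sit over rational primes of pole mass `≤ 1/2` in `ℚ(λ)`,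
`log(q^{∤{2,l}}(λ)) ≤ (B_III(P,l) + ((l+5)/4)·log π) / ((l+1)/24 − 1/(2l))` — leading term `≈ 40·log(d*_mod·l)·π(d*_mod·l)`,
the same as abc-iut-c312-d1's SUFFICIENT threshold `hullVolumeAtDatum_BIII_of_logQAvoid_le` (below which the hull
estimate is a theorem): on the locus `hreg` at `(P, l)` is pinned between two explicit Szpiro-type height bounds whose
difference is of lower order (`O(d_mod·log(d*_mod·l)·(log-diff + log-cond) + d*_mod·log(d*_mod·l)/l)`). Nothing asserted
about any point; no side taken. [claim: Mochizuki2012, status: disputed] [cite: Mochizuki2012, IUTchIV Thm. 1.10 Step (viii) p. 30–31] -/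
theorem logQAvoid_le_of_hreg_of_splitBadPoint
    (hreg : ∀ P : NFPoint, P ∈ UP → ∀ l : ℕ, l.Prime → 5 ≤ l →
      Cor22.AdmitsCore P → Cor22.CondP2 P l → Cor22.CondP5 P l → Cor22.CondP6 P l →
      ∀ T : Cor22.ThetaVolumeDatumAt P l,
        (letI := T.instFieldF; letI := T.instNumberFieldF; letI := T.instAlgebraF; letI := T.instFieldK
         letI := T.instNumberFieldK; letI := T.instAlgebraK; letI := T.instFieldFbar; letI := T.instAlgebraFbar
         letI := T.instAlgebraKFbar; letI := T.instIsElliptic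
         ¬ (∀ p ∈ T.I.supportPrimes, ∀ v w : placesOver (fieldOfModuli T.E) p,
            (Summit.ABC.IUTFork.DHData.ofInput T.I).logQloc p v = (Summit.ABC.IUTFork.DHData.ofInput T.I).logQloc p w)) →
        T.HullEstimateOf
          (((l : ℝ) + 1) / 4 *
            ((1 + 12 * (Cor22.dmod P : ℝ) / l) * (P.logDiff + Cor22.logCondAvoid P {2, l})
              + 2 * Real.log l + 52
              + 20 / 3 * Real.log (((2 ^ 12 * 3 ^ 3 * 5 * Cor22.dmod P : ℕ) : ℝ) * (l : ℝ))
                * (Nat.primeCounting (2 ^ 12 * 3 ^ 3 * 5 * Cor22.dmod P * l) : ℝ))))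
    {P : NFPoint} (hP : P ∈ UP) {l : ℕ} (hl : l.Prime) (h5 : 5 ≤ l)
    (hc : Cor22.AdmitsCore P) (h2 : Cor22.CondP2 P l) (h5' : Cor22.CondP5 P l) (h6 : Cor22.CondP6 P l)
    (hsplit : ∀ (p : ℕ) [Fact p.Prime], ∑ V : placesOver P.F p,
      ((Cor22.badPlacesAvoid P {2, l} : Finset _) : Set (HeightOneSpectrum (𝓞 P.F))).indicator (weight P.F) V.1 ≤ 1 / 2) :
    Cor22.logQAvoid P {2, l} ≤
      (((l : ℝ) + 1) / 4 *
          ((1 + 12 * (Cor22.dmod P : ℝ) / l) * (P.logDiff + Cor22.logCondAvoid P {2, l})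
            + 2 * Real.log l + 52
            + 20 / 3 * Real.log (((2 ^ 12 * 3 ^ 3 * 5 * Cor22.dmod P : ℕ) : ℝ) * (l : ℝ))
              * (Nat.primeCounting (2 ^ 12 * 3 ^ 3 * 5 * Cor22.dmod P * l) : ℝ))
        + ThetaVolumeInput.archLogTheta l) / (((l : ℝ) + 1) / 24 - 1 / (2 * l)) := by
  have hsq := squeeze_of_hreg_of_splitBadPoint hreg hP hl h5 hc h2 h5' h6 hsplit
  have hl5 : (5 : ℝ) ≤ l := by exact_mod_cast h5
  have hc0 : (0 : ℝ) < ((l : ℝ) + 1) / 24 - 1 / (2 * l) := by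
    rw [sub_pos, div_lt_div_iff₀ (by positivity) (by positivity)]
    nlinarith
  rw [le_div_iff₀ hc0, mul_comm]
  exact hsq

end Summit.ABC.IUTFork

end
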